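import Mathlib
import HarnessLib

/-!
# Route `RadicialJung`, crux `CleanModels` (stmt-15917), stub `stub_cleanLU3DefectNonDiscrete`, sub-line (C): representatives of the `K^p`-line
# under a change of generator `u = α^p g₀ + β^p` (piece «lineRep» of the lead's brief `Lines/Sketch-brief-Cdiv-subline.md`)

Line `Sketch` rev 24 of crux stmt-ResolutionOfSingularities-15917; lead `res-B-lead-1` g3.  OURS; nothing here proves resolution in
characteristic `p`.  The conclusion of the `CleanLU3` stubs quantifies over representatives `Σ_{j<p} c_j^p g₀^j` of the `K^p`-line of `g₀`.
In the inert branch of the composite sub-line one works with the generator `u = (g₀ - a^p)/c^p = α^p g₀ + β^p` (`α = c⁻¹`, `β = -a/c`)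
instead; this file shows that every representative written in `u` is a representative written in `g₀` (same `K^p(g₀) = K^p(u)`), with
non-triviality preserved: substitute `X ↦ α^p X + β^p` in the polynomial `Σ c_j^p X^j = (Σ c_j X^j)^{Frob}` — Frobenius commutes with composition.

* `eval_map_frobenius_eq_sum` — `((Σ_{j<p} C c_j X^j).map Frob).eval x = Σ_{j<p} c_j^p x^j`.
* `lineRep_change_of_generator` — `∀ c, ∃ c′, Σ c_j^p (α^p g₀ + β^p)^j = Σ c′_j^p g₀^j`, and `c′` is non-trivial if `c` is (`α ≠ 0`).
-/

noncomputable section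

set_option linter.dupNamespace false -- mandated namespace of this single-conjunct summit

open Polynomial

namespace Summit.ResolutionOfSingularities.ResolutionOfSingularities.Theorems.RadicialJung.CleanModels

variable {K : Type} [Field K]

/-- The polynomial `Σ_{j<p} C (c j) X^j` attached to a coefficient vector. -/
private theorem coeff_sum_C_mul_X_pow (p : ℕ) (c : Fin p → K) (n : ℕ) :
    (∑ j : Fin p, C (c j) * X ^ (j : ℕ)).coeff n = if h : n < p then c ⟨n, h⟩ else 0 := by
  rw [finsetSum_coeff]
  simp only [coeff_C_mul_X_pow]
  split_ifs with h
  · rw [Finset.sum_eq_single ⟨n, h⟩]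
    · simp
    · intro j _ hj
      rw [if_neg]
      intro hn
      exact hj (Fin.ext hn.symm)
    · intro hn; exact absurd (Finset.mem_univ _) hn
  · refine Finset.sum_eq_zero fun j _ => ?_
    rw [if_neg]
    intro hn
    exact h (hn ▸ j.2)

/-- `natDegree (Σ_{j<p} C (c j) X^j) < p` (for `p ≠ 0`). -/
private theorem natDegree_sum_lt (p : ℕ) (hp : p ≠ 0) (c : Fin p → K) :
    (∑ j : Fin p, C (c j) * X ^ (j : ℕ)).natDegree < p := by
  rw [Nat.lt_iff_le_pred (Nat.pos_of_ne_zero hp)]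
  refine natDegree_sum_le_of_forall_le _ _ fun j _ => ?_
  calc (C (c j) * X ^ (j : ℕ)).natDegree ≤ (j : ℕ) := natDegree_C_mul_X_pow_le _ _
    _ ≤ p - 1 := by have := j.2; omega

/-- **Evaluation of a Frobenius-twisted polynomial of degree `< p`**: `(P.map Frob).eval x = Σ_{j<p} (P.coeff j)^p x^j`. [folklore] -/
theorem eval_map_frobenius_eq_sum (p : ℕ) [hp : Fact p.Prime] [CharP K p] (P : K[X]) (hP : P.natDegree < p) (x : K) :
    (P.map (frobenius K p)).eval x = ∑ j : Fin p, P.coeff (j : ℕ) ^ p * x ^ (j : ℕ) := by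
  rw [eval_eq_sum_range' (n := p), Fin.sum_univ_eq_sum_range (fun j => P.coeff j ^ p * x ^ j) p]
  · refine Finset.sum_congr rfl fun j _ => ?_
    rw [coeff_map, frobenius_def]
  · calc (P.map (frobenius K p)).natDegree ≤ P.natDegree := natDegree_map_le
      _ < p := hP

/-- **Change of generator in the `K^p`-line** (characteristic `p`): for `u = α^p g₀ + β^p` with `α ≠ 0`, every representative `Σ_{j<p} c_j^p u^j`
equals some `Σ_{j<p} c′_j^p g₀^j`, and `c′` has a non-zero coefficient of positive index whenever `c` has. [folklore] -/
theorem lineRep_change_of_generator (p : ℕ) [hp : Fact p.Prime] [CharP K p] (g₀ α β : K) (hα : α ≠ 0) (c : Fin p → K) :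
    ∃ c' : Fin p → K, (∑ j : Fin p, c j ^ p * (α ^ p * g₀ + β ^ p) ^ (j : ℕ)) = ∑ j : Fin p, c' j ^ p * g₀ ^ (j : ℕ) ∧
      ((∃ j : Fin p, (j : ℕ) ≠ 0 ∧ c j ≠ 0) → ∃ j : Fin p, (j : ℕ) ≠ 0 ∧ c' j ≠ 0) := by
  have hp0 : p ≠ 0 := hp.out.ne_zero
  set Q : K[X] := ∑ j : Fin p, C (c j) * X ^ (j : ℕ) with hQ
  set L : K[X] := C α * X + C β with hL
  have hLdeg : L.natDegree = 1 := by rw [hL, natDegree_add_C, natDegree_C_mul_X α hα]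
  have hQdeg : Q.natDegree < p := natDegree_sum_lt p hp0 c
  have hQLdeg : (Q.comp L).natDegree < p := by
    calc (Q.comp L).natDegree ≤ Q.natDegree * L.natDegree := natDegree_comp_le
      _ = Q.natDegree := by rw [hLdeg, mul_one]
      _ < p := hQdeg
  have hQcoeff : ∀ j : Fin p, Q.coeff (j : ℕ) = c j := fun j => by
    rw [hQ, coeff_sum_C_mul_X_pow, dif_pos j.2]
  refine ⟨fun j => (Q.comp L).coeff (j : ℕ), ?_, ?_⟩
  · -- both sides are evaluations of Frobenius-twisted polynomials
    have h1 : (∑ j : Fin p, c j ^ p * (α ^ p * g₀ + β ^ p) ^ (j : ℕ)) = (Q.map (frobenius K p)).eval (α ^ p * g₀ + β ^ p) := by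
      rw [eval_map_frobenius_eq_sum p Q hQdeg]
      simp only [hQcoeff]
    have h2 : (∑ j : Fin p, (Q.comp L).coeff (j : ℕ) ^ p * g₀ ^ (j : ℕ)) = ((Q.comp L).map (frobenius K p)).eval g₀ :=
      (eval_map_frobenius_eq_sum p (Q.comp L) hQLdeg g₀).symm
    rw [h1, h2, Polynomial.map_comp, eval_comp]
    congr 1
    rw [hL, Polynomial.map_add, Polynomial.map_mul, map_C, map_X, map_C, eval_add, eval_mul, eval_C, eval_X, eval_C,
      frobenius_def, frobenius_def]
  · rintro ⟨j, hj0, hj⟩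
    -- `Q` has positive degree, hence so has `Q.comp L`
    have hQj : Q.coeff (j : ℕ) ≠ 0 := by rw [hQcoeff]; exact hj
    have hdegQ : (j : ℕ) ≤ Q.natDegree := le_natDegree_of_ne_zero hQj
    have hQne : Q ≠ 0 := fun h0 => hQj (by rw [h0, coeff_zero])
    have hcomp : (Q.comp L).natDegree = Q.natDegree := by rw [natDegree_comp, hLdeg, mul_one]
    have hQLne : Q.comp L ≠ 0 := by
      intro h0
      have := congrArg natDegree h0
      rw [hcomp, natDegree_zero] at this
      omega
    refine ⟨⟨(Q.comp L).natDegree, hQLdeg⟩, ?_, ?_⟩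
    · show (Q.comp L).natDegree ≠ 0
      rw [hcomp]; omega
    · show (Q.comp L).coeff (Q.comp L).natDegree ≠ 0
      rw [← leadingCoeff]
      exact leadingCoeff_ne_zero.mpr hQLne

end Summit.ResolutionOfSingularities.ResolutionOfSingularities.Theorems.RadicialJung.CleanModels

end
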